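import Summits.QuantumFields.GaugeBoot.DiagonalRPTorusOddAverage
import HarnessLib

/-!
# Diagonal RP on the ODD two-dimensional torus, IV: the odd partition of the plaquettes, the
mirror Gram kernel and the pointwise factorisation (gauge-boot, task L3(θ))

HONEST FRAMING (cell `pub-gaugeboot`, page 1 of every file): the venture produces certified bounds
on lattice expectations at stated coupling, gauge group, dimension and torus size; NOT a mass gap,
NOT a continuum limit, NOT a string tension; NOT Yang–Mills-summit-bearing (barriers
`FixedCouplingUltralocality`, `PerturbativeInvisibility`). This module is part of a small POSITIVE
structural result about which positivity constraints a two-dimensional TORUS certificate may use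
(no two-dimensional certificate with a diagonal block exists or is planned); it discharges nothing
else.

Continuation of `DiagonalRPTorusOddZigzag.lean` / `…OddAction.lean` / `…OddAverage.lean`
(notation there; odd `L = 2c + 1 ≥ 3`).

* Odd-torus geometry of the closed half: the links of a mirror transport `C_y` and of an interior
  plaquette lie in the closed half (`inHalf_cT_links'`, `inHalf_blk'`, for `L ≥ 3`; the even-torus
  versions in the tree assume `L ≥ 4`), so the positive-side observable `g = F e^{β S_int}`
  (`gObs`) reads only the closed half (`dependsOn_gObs'`) and does not see the fibrewise action
  (`gObs_zigM`, `gObs_configDiagSwap_zigM`) nor the difference between `Θ` and `Θ″`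
  (`gObs_configDiagSwap_eq`); the swap carries the closed half OFF the closed half
  (`not_inHalf_edgeDiagSwap_odd` — for odd `L` the two closed halves share no link).
* The odd partition of the plaquette sum: `Σ_y = Σ_{k=0} + Σ_{k=c} + Σ_{0<k<c} + Σ_{k>c}`
  (`sum_split'`) with `Σ_{k>c} r_y(U) = Σ_{0<k<c} r_y(ΘU) + Σ_{k=c} r_y(ΘU)` (`sum_Sm_eq_odd`:
  the swap carries the layers `1, …, c` onto the layers `c+1, …, 2c`).
* The mirror crossing weight `E₀ = exp(β Σ_{k(y)=0} r_y)` (`mirrorE`), its Gram coefficients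
  (`ocoeff`, from `gterm` of `DiagonalRPTorusTwoGram.lean`) with
  `Σ_ι a_ι(U) conj a_ι(Θ″U) = β Σ_{k(y)=0} r_y(U)` (`sum_ocoeff_mul_conj`, `β ≥ 0`), and its
  invariances (`mirrorE_zigM`, `mirrorE_configDiagSwap`).
* The RP integrand `Φ_odd = g · conj(g∘Θ) · E₀ · A · (A∘Θ)` (`rpPhiOdd`, `A = layerW`) and
  **`rpIntegrand_eq_odd`**: `e^{-βS(U)} conj F(ΘU) F(U) = e^{-βN#P} Φ_odd(U)`.

Continued (and concluded) in `DiagonalRPTorusOdd.lean`. All statements are elementary and proved.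
-/

open MeasureTheory Complex Finset Function
open scoped ComplexOrder ENNReal

namespace Summit.QuantumFields.GaugeBoot

open Literature.MathematicalPhysics.QuantumFieldTheory

noncomputable section

namespace DiagRPTwo

/-! ## The closed half of the odd torus -/

section Half

variable {L : ℕ} [NeZero L] {i j : Fin 2}

omit [NeZero L] in
/-- Representative of `k + 1` below the layer `c` (`L ≥ 3`). -/
theorem val_add_one_of_lt' (h3 : 3 ≤ L) {k : ZMod L} (hk : k.val < L / 2) :
    (k + 1).val = k.val + 1 := by
  rw [ZMod.val_add_of_lt, val_one_of_three_le h3]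
  rw [val_one_of_three_le h3]
  omega

/-- Representative of `k - 1` above the mirror (`L ≥ 3`). -/
theorem val_sub_one_of_pos' (h3 : 3 ≤ L) {k : ZMod L} (hk : 0 < k.val) :
    (k - 1).val = k.val - 1 := by
  rw [ZMod.val_sub, val_one_of_three_le h3]
  rw [val_one_of_three_le h3]
  omega

omit [NeZero L] in
/-- The two links of a mirror transport `C_y` are links of the closed half (`L ≥ 3`). -/
theorem inHalf_cT_links' (h3 : 3 ≤ L) (hij : i ≠ j) {y : Site 2 L} (hy : kd i j y = 0) :
    InHalf i j (y, i) ∧ InHalf i j (y.shift i, j) := by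
  have hv : (kd i j y).val = 0 := by rw [hy, ZMod.val_zero]
  have hv1 : (kd i j (y.shift i)).val = 1 := by
    rw [kd_shift_left hij, hy, zero_add, val_one_of_three_le h3]
  have hv2 : kd i j ((y.shift i).shift j) = kd i j y := by
    rw [kd_shift_right hij, kd_shift_left hij]; ring
  refine ⟨⟨by simp only [hv]; omega, by simp only [hv1]; omega⟩,
    ⟨by simp only [hv1]; omega, by simp only [hv2, hv]; omega⟩⟩

/-- The four links of an interior plaquette of the half are links of the closed half (`L ≥ 3`). -/
theorem inHalf_blk' (h3 : 3 ≤ L) (hij : i ≠ j) {y : Site 2 L} (hy : y ∈ Sp i j) {e : Edge 2 L}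
    (he : e ∈ blk i j y) : InHalf i j e := by
  rw [mem_Sp] at hy
  have hvi : (kd i j (y.shift i)).val = (kd i j y).val + 1 := by
    rw [kd_shift_left hij, val_add_one_of_lt' h3 hy.2]
  have hvj : (kd i j (y.shift j)).val = (kd i j y).val - 1 := by
    rw [kd_shift_right hij, val_sub_one_of_pos' h3 hy.1]
  have hij' : kd i j ((y.shift i).shift j) = kd i j y := by
    rw [kd_shift_right hij, kd_shift_left hij]; ring
  have hji' : kd i j ((y.shift j).shift i) = kd i j y := by
    rw [kd_shift_left hij, kd_shift_right hij]; ring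
  rw [mem_blk] at he
  rcases he with rfl | rfl | rfl | rfl <;> constructor <;>
    simp only [hvi, hvj, hij', hji'] <;> omega

/-- A residue whose own and whose negative's representatives are both `≤ L/2` vanishes (odd `L`). -/
theorem eq_zero_of_val_le_of_neg_val_le (hL : Odd L) {m : ZMod L} (h1 : m.val ≤ L / 2)
    (h2 : (-m).val ≤ L / 2) : m = 0 := by
  by_contra hm
  rw [val_neg_of_ne_zero' hm] at h2
  obtain ⟨r, hr⟩ := hL
  omega

/-- **For odd `L` the swap carries every link of the closed half off the closed half** (`L ≥ 3`). -/
theorem not_inHalf_edgeDiagSwap_odd (hL : Odd L) (h3 : 3 ≤ L) (hij : i ≠ j) {e : Edge 2 L}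
    (he : InHalf i j e) : ¬InHalf i j (edgeDiagSwap i j e) := by
  intro he'
  obtain ⟨y, μ⟩ := e
  simp only [InHalf, edgeDiagSwap] at he he'
  rw [← siteDiagSwap_shift, kd_siteDiagSwap, kd_siteDiagSwap] at he'
  have h0 : kd i j y = 0 := eq_zero_of_val_le_of_neg_val_le hL he.1 he'.1
  have h1 : kd i j (y.shift μ) = 0 := eq_zero_of_val_le_of_neg_val_le hL he.2 he'.2
  haveI := nontrivial_zmod_of_three_le h3
  obtain hμ | hμ := ((by decide : ∀ a b c : Fin 2, a ≠ b → c = a ∨ c = b) i j μ hij) <;> subst hμ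
  · rw [kd_shift_left hij, h0, zero_add] at h1
    exact one_ne_zero h1
  · rw [kd_shift_right hij, h0, zero_sub, neg_eq_zero] at h1
    exact one_ne_zero h1

/-- A link of the closed half is not a zigzag link (`L ≥ 3`). -/
theorem not_zm_of_inHalf (h3 : 3 ≤ L) (hij : i ≠ j) {e : Edge 2 L} (he : InHalf i j e) :
    ¬ZM i j e := fun hz => not_inHalf_of_zm h3 hij hz he

end Half

/-! ## The positive-side observable on the odd torus -/

section GObs

variable {L N : ℕ} [NeZero L] {i j : Fin 2} {G : Type*} [Group G]
  (ρ : G →* Matrix (Fin N) (Fin N) ℂ)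

/-- `g` reads only links of the closed half (`L ≥ 3`). -/
theorem dependsOn_gObs' (h3 : 3 ≤ L) (hij : i ≠ j) (β : ℝ) {F : GaugeConfig 2 L G → ℂ}
    (hFH : IsDiagonalHalfObservable i j F) :
    DependsOn (gObs ρ i j β F) (halfLinks (L := L) i j : Set (Edge 2 L)) := by
  intro U V hUV
  have hF : F U = F V := dependsOn_halfLinks hFH hUV
  have hS : ∑ y ∈ Sp i j, rr ρ i j U y = ∑ y ∈ Sp i j, rr ρ i j V y :=
    dependsOn_sum_rr ρ i j (Sp i j) fun e he => hUV e (by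
      obtain ⟨y, hy, hey⟩ := Finset.mem_biUnion.1 he
      exact Finset.mem_coe.2 (mem_halfLinks.2 (inHalf_blk' h3 hij hy hey)))
  simp only [gObs, hF, hS]

/-- `g` does not see the fibrewise action (`L ≥ 3`). -/
theorem gObs_zigM (h3 : 3 ≤ L) (hij : i ≠ j) (β : ℝ) {F : GaugeConfig 2 L G → ℂ}
    (hFH : IsDiagonalHalfObservable i j F) (h : Site 2 L → G) (U : GaugeConfig 2 L G) :
    gObs ρ i j β F (zigM i j h U) = gObs ρ i j β F U :=
  dependsOn_gObs' ρ h3 hij β hFH fun _ he =>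
    zigM_apply_of_not_zm _ _ (not_zm_of_inHalf h3 hij (mem_halfLinks.1 (Finset.mem_coe.1 he)))

/-- `g ∘ Θ` does not see the fibrewise action (odd `L ≥ 3`). -/
theorem gObs_configDiagSwap_zigM (hL : Odd L) (h3 : 3 ≤ L) (hij : i ≠ j) (β : ℝ)
    {F : GaugeConfig 2 L G → ℂ} (hFH : IsDiagonalHalfObservable i j F) (h : Site 2 L → G)
    (U : GaugeConfig 2 L G) :
    gObs ρ i j β F (configDiagSwap i j (zigM i j h U)) = gObs ρ i j β F (configDiagSwap i j U) := by
  rw [configDiagSwap_zigM hL hij, gObs_zigM ρ h3 hij β hFH]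

/-- `g ∘ Θ = g ∘ Θ″` (`L ≥ 3`). -/
theorem gObs_configDiagSwap_eq (h3 : 3 ≤ L) (hij : i ≠ j) (β : ℝ) {F : GaugeConfig 2 L G → ℂ}
    (hFH : IsDiagonalHalfObservable i j F) (U : GaugeConfig 2 L G) :
    gObs ρ i j β F (configDiagSwap i j U) = gObs ρ i j β F (configOddSwap i j U) :=
  dependsOn_gObs' ρ h3 hij β hFH fun _ he =>
    (configOddSwap_apply_of_not_zm U
      (not_zm_of_inHalf h3 hij (mem_halfLinks.1 (Finset.mem_coe.1 he)))).symm

end GObs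

/-! ## The odd partition of the plaquettes -/

section Partition

variable {L : ℕ} [NeZero L] {i j : Fin 2}

/-- The four families `S0, Sc, Sp, Sm` partition the sites (`L ≥ 2`). -/
theorem sum_split' (h2 : 2 ≤ L) (i j : Fin 2) (f : Site 2 L → ℝ) :
    ∑ y, f y = ∑ y ∈ S0 i j, f y + ∑ y ∈ Sc i j, f y + ∑ y ∈ Sp i j, f y + ∑ y ∈ Sm i j, f y := by
  simp only [S0, Sc, Sp, Sm, Finset.sum_filter, ← Finset.sum_add_distrib]
  refine Finset.sum_congr rfl fun y _ => ?_
  have h1 : 1 ≤ L / 2 := by omega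
  split_ifs <;> first | (simp; done) | (exfalso; omega)

/-- **The swap carries the layers `1, …, c` onto the layers `c + 1, …, 2c`** (odd `L`):
`Σ_{k>c} f(y) = Σ_{0<k<c} f(θy) + Σ_{k=c} f(θy)` (`L ≥ 3`). -/
theorem sum_Sm_eq_odd (hL : Odd L) (h3 : 3 ≤ L) (i j : Fin 2) (f : Site 2 L → ℝ) :
    ∑ y ∈ Sm i j, f y = ∑ y ∈ Sp i j, f (siteDiagSwap i j y) + ∑ y ∈ Sc i j, f (siteDiagSwap i j y) := by
  obtain ⟨r, hr⟩ := hL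
  have hdisj : Disjoint (Sp (L := L) i j) (Sc i j) :=
    Finset.disjoint_left.2 fun y h1 h2 => by rw [mem_Sp] at h1; rw [mem_Sc] at h2; omega
  rw [← Finset.sum_union hdisj]
  symm
  refine Finset.sum_nbij' (siteDiagSwap i j) (siteDiagSwap i j) ?_ ?_
    (fun y _ => siteDiagSwap_siteDiagSwap i j y) (fun y _ => siteDiagSwap_siteDiagSwap i j y)
    (fun y _ => rfl)
  · intro y hy
    rw [Finset.mem_union, mem_Sp, mem_Sc] at hy
    have hlt := ZMod.val_lt (kd i j y)
    have hne : kd i j y ≠ 0 := fun h => by rw [h, ZMod.val_zero] at hy; omega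
    rw [mem_Sm, kd_siteDiagSwap, val_neg_of_ne_zero' hne]
    omega
  · intro y hy
    rw [mem_Sm] at hy
    have hlt := ZMod.val_lt (kd i j y)
    have hne : kd i j y ≠ 0 := fun h => by rw [h, ZMod.val_zero] at hy; omega
    rw [Finset.mem_union, mem_Sp, mem_Sc, kd_siteDiagSwap, val_neg_of_ne_zero' hne]
    omega

end Partition

/-! ## The mirror crossing weight and its Gram coefficients -/

section Mirror

variable {L N : ℕ} [NeZero L] {G : Type*} [Group G] [TopologicalSpace G]
  [IsTopologicalGroup G] [CompactSpace G] (ρ : G →* Matrix (Fin N) (Fin N) ℂ) {i j : Fin 2}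

variable (i j) in
/-- The mirror crossing weight `E₀(U) = exp(β Σ_{k(y)=0} r_y(U))`. -/
def mirrorE (β : ℝ) (U : GaugeConfig 2 L G) : ℝ := Real.exp (β * ∑ y ∈ S0 i j, rr ρ i j U y)

omit [TopologicalSpace G] [IsTopologicalGroup G] [CompactSpace G] in
/-- `E₀` does not see the fibrewise action (`L ≥ 3`). -/
theorem mirrorE_zigM (h3 : 3 ≤ L) (hij : i ≠ j) (β : ℝ) (h : Site 2 L → G) (U : GaugeConfig 2 L G) :
    mirrorE ρ i j β (zigM i j h U) = mirrorE ρ i j β U := by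
  have h0 : ∑ y ∈ S0 i j, rr ρ i j (zigM i j h U) y = ∑ y ∈ S0 i j, rr ρ i j U y :=
    Finset.sum_congr rfl fun y hy =>
      rr_zigM_of_kd_eq_zero ρ h3 hij h U ((kd_eq_zero_iff y).2 (mem_S0.1 hy))
  rw [mirrorE, mirrorE, h0]

/-- `E₀ ∘ Θ = E₀` (the swap fixes the mirror sites). -/
theorem mirrorE_configDiagSwap (hρ : Continuous ρ) (hij : i ≠ j) (β : ℝ) (U : GaugeConfig 2 L G) :
    mirrorE ρ i j β (configDiagSwap i j U) = mirrorE ρ i j β U := by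
  have h0 : ∑ y ∈ S0 i j, rr ρ i j (configDiagSwap i j U) y = ∑ y ∈ S0 i j, rr ρ i j U y :=
    Finset.sum_congr rfl fun y hy => by
      rw [rr_configDiagSwap ρ hρ,
        siteDiagSwap_eq_self_of_kd_eq_zero hij ((kd_eq_zero_iff y).2 (mem_S0.1 hy))]
  rw [mirrorE, mirrorE, h0]

/-- `E₀ ≤ exp(|β| |S0| N)`. -/
theorem mirrorE_le (hρ : Continuous ρ) (β : ℝ) (U : GaugeConfig 2 L G) :
    mirrorE ρ i j β U ≤ Real.exp (|β| * ((S0 (L := L) i j).card * N)) := by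
  refine Real.exp_le_exp.2 ?_
  calc β * ∑ y ∈ S0 i j, rr ρ i j U y ≤ |β * ∑ y ∈ S0 i j, rr ρ i j U y| := le_abs_self _
    _ = |β| * |∑ y ∈ S0 i j, rr ρ i j U y| := abs_mul _ _
    _ ≤ |β| * ((S0 (L := L) i j).card * N) :=
        mul_le_mul_of_nonneg_left (abs_sum_rr_le ρ hρ i j _ U) (abs_nonneg β)

/-- `‖(E₀ : ℂ)‖ ≤ exp(|β| |S0| N)`. -/
theorem norm_mirrorE_le (hρ : Continuous ρ) (β : ℝ) (U : GaugeConfig 2 L G) :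
    ‖(mirrorE ρ i j β U : ℂ)‖ ≤ Real.exp (|β| * ((S0 (L := L) i j).card * N)) := by
  rw [Complex.norm_real, Real.norm_eq_abs, abs_of_pos (show 0 < mirrorE ρ i j β U from Real.exp_pos _)]
  exact mirrorE_le ρ hρ β U

omit [CompactSpace G] in
/-- `E₀` is measurable (as a complex-valued function). -/
theorem measurable_mirrorE [MeasurableSpace G] [BorelSpace G] [SecondCountableTopology G]
    (hρ : Continuous ρ) (β : ℝ) : Measurable fun U : GaugeConfig 2 L G => (mirrorE ρ i j β U : ℂ) :=
  Complex.measurable_ofReal.comp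
    ((Finset.measurable_sum _ fun y _ => measurable_rr ρ hρ i j y).const_mul β).exp

variable (i j) in
/-- The Gram coefficient functions of the mirror crossing: the coefficients of `C_y` for `y` on
the mirror, zero otherwise. -/
def ocoeff (hρ : Continuous ρ) (β : ℝ) (ι : GramIndex L N) (U : GaugeConfig 2 L G) : ℂ :=
  if kd i j ι.1 = 0 then gterm ρ hρ β (cT i j U ι.1) ι.2 else 0

omit [NeZero L] in
/-- The coefficient functions are bounded by `√(β/2)`. -/
theorem norm_ocoeff_le (hρ : Continuous ρ) (β : ℝ) (ι : GramIndex L N) (U : GaugeConfig 2 L G) :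
    ‖ocoeff ρ i j hρ β ι U‖ ≤ Real.sqrt (β / 2) := by
  unfold ocoeff
  split_ifs
  · exact norm_gterm_le ρ hρ β _ _
  · rw [norm_zero]; exact Real.sqrt_nonneg _

/-- The coefficient functions read only links of the closed half (`L ≥ 3`). -/
theorem dependsOn_ocoeff (h3 : 3 ≤ L) (hij : i ≠ j) (hρ : Continuous ρ) (β : ℝ) (ι : GramIndex L N) :
    DependsOn (ocoeff ρ i j hρ β ι) (halfLinks (L := L) i j : Set (Edge 2 L)) := by
  intro U V hUV
  unfold ocoeff
  split_ifs with h
  · obtain ⟨h1, h2⟩ := inHalf_cT_links' h3 hij h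
    have hU1 : U (ι.1, i) = V (ι.1, i) := hUV _ (Finset.mem_coe.2 (mem_halfLinks.2 h1))
    have hU2 : U (ι.1.shift i, j) = V (ι.1.shift i, j) := hUV _ (Finset.mem_coe.2 (mem_halfLinks.2 h2))
    simp only [cT, hU1, hU2]
  · rfl

omit [NeZero L] in
/-- The coefficient functions are measurable. -/
theorem measurable_ocoeff [MeasurableSpace G] [BorelSpace G] [SecondCountableTopology G]
    (hρ : Continuous ρ) (β : ℝ) (ι : GramIndex L N) :
    Measurable (ocoeff (G := G) ρ i j hρ β ι) := by
  unfold ocoeff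
  split_ifs
  · exact (measurable_gterm ρ hρ β ι.2).comp (measurable_cT i j ι.1)
  · exact measurable_const

omit [NeZero L] [TopologicalSpace G] [IsTopologicalGroup G] [CompactSpace G] in
/-- `C_y(Θ″U) = D_y(U)` on the mirror (`L ≥ 3`): the mirror links are not zigzag links and the
swap fixes the mirror sites. -/
theorem cT_configOddSwap_of_kd_eq_zero (h3 : 3 ≤ L) (hij : i ≠ j) (U : GaugeConfig 2 L G)
    {y : Site 2 L} (hy : kd i j y = 0) : cT i j (configOddSwap i j U) y = dT i j U y := by
  have h1 : ¬ZM i j (y, i) := not_zm_of_mem_blk_of_kd_eq_zero h3 hij hy (by simp [blk])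
  have h2 : ¬ZM i j (y.shift i, j) := not_zm_of_mem_blk_of_kd_eq_zero h3 hij hy (by simp [blk])
  rw [cT, configOddSwap_apply_of_not_zm U h1, configOddSwap_apply_of_not_zm U h2, dT]
  simp only [edgeDiagSwap, siteDiagSwap_shift, Equiv.swap_apply_left, Equiv.swap_apply_right,
    siteDiagSwap_eq_self_of_kd_eq_zero hij hy]

/-- **The mirror crossing weight is a Gram kernel for `Θ″`**:
`Σ_ι a_ι(U) conj a_ι(Θ″U) = β Σ_{k(y)=0} r_y(U)` (`β ≥ 0`, `L ≥ 3`). -/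
theorem sum_ocoeff_mul_conj (h3 : 3 ≤ L) (hij : i ≠ j) (hρ : Continuous ρ) {β : ℝ} (hβ : 0 ≤ β)
    (U : GaugeConfig 2 L G) :
    ∑ ι, ocoeff ρ i j hρ β ι U * (starRingEnd ℂ) (ocoeff ρ i j hρ β ι (configOddSwap i j U)) =
      ((β * ∑ y ∈ S0 i j, rr ρ i j U y : ℝ) : ℂ) := by
  classical
  have hy : ∀ y : Site 2 L,
      ∑ k : Fin N × Fin N × Bool, ocoeff ρ i j hρ β (y, k) U *
          (starRingEnd ℂ) (ocoeff ρ i j hρ β (y, k) (configOddSwap i j U)) =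
        ((if kd i j y = 0 then β * rr ρ i j U y else 0 : ℝ) : ℂ) := by
    intro y
    by_cases h0 : kd i j y = 0
    · simp only [ocoeff, h0, ↓reduceIte, cT_configOddSwap_of_kd_eq_zero h3 hij U h0]
      rw [sum_gterm_mul_conj ρ hρ hβ, rr]
    · simp only [ocoeff, h0, ↓reduceIte, zero_mul, Finset.sum_const_zero, Complex.ofReal_zero]
  have hS : (Finset.univ.filter fun y : Site 2 L => kd i j y = 0) = S0 i j := by
    ext y; rw [Finset.mem_filter, mem_S0, kd_eq_zero_iff]; simp
  rw [Fintype.sum_prod_type]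
  simp_rw [hy]
  rw [← Complex.ofReal_sum, ← Finset.sum_filter, ← Finset.mul_sum, hS]

end Mirror

/-! ## The RP integrand of the odd torus and the pointwise factorisation -/

section Integrand

variable {L N : ℕ} [NeZero L] {G : Type*} [Group G] [TopologicalSpace G]
  [IsTopologicalGroup G] [CompactSpace G] (ρ : G →* Matrix (Fin N) (Fin N) ℂ) {i j : Fin 2}

variable (i j) in
/-- The RP integrand of the odd torus: `Φ_odd(U) = g(U) conj g(ΘU) E₀(U) A(U) A(ΘU)`. -/
def rpPhiOdd (β : ℝ) (F : GaugeConfig 2 L G → ℂ) (U : GaugeConfig 2 L G) : ℂ :=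
  gObs ρ i j β F U * (starRingEnd ℂ) (gObs ρ i j β F (configDiagSwap i j U)) *
    (mirrorE ρ i j β U : ℂ) * (layerW ρ i j β U : ℂ) * (layerW ρ i j β (configDiagSwap i j U) : ℂ)

/-- **The pointwise factorisation of the RP integrand on the odd torus**:
`e^{-βS(U)} conj F(ΘU) F(U) = e^{-βN#P} Φ_odd(U)` (odd `L ≥ 3`). -/
theorem rpIntegrand_eq_odd (hL : Odd L) (h3 : 3 ≤ L) (hij : i ≠ j) (hρ : Continuous ρ) (β : ℝ)
    (F : GaugeConfig 2 L G → ℂ) (U : GaugeConfig 2 L G) :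
    (Real.exp (-β * wilsonAction ρ U) : ℂ) * ((starRingEnd ℂ) (F (configDiagSwap i j U)) * F U) =
      (Real.exp (-(β * (N * Fintype.card (Plaquette 2 L)))) : ℂ) * rpPhiOdd ρ i j β F U := by
  have hSm : ∑ y ∈ Sm i j, rr ρ i j U y =
      ∑ y ∈ Sp i j, rr ρ i j (configDiagSwap i j U) y + ∑ y ∈ Sc i j, rr ρ i j (configDiagSwap i j U) y := by
    rw [sum_Sm_eq_odd hL h3 i j]
    simp only [rr_configDiagSwap ρ hρ i j U]
  rw [wilsonAction_eq_sum_rr ρ hρ hij, sum_split' (by omega) i j, hSm, rpPhiOdd, gObs, gObs, mirrorE,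
    layerW, layerW]
  simp only [map_mul, Complex.conj_ofReal]
  rw [show -β * (↑N * ↑(Fintype.card (Plaquette 2 L)) -
        (∑ y ∈ S0 i j, rr ρ i j U y + ∑ y ∈ Sc i j, rr ρ i j U y + ∑ y ∈ Sp i j, rr ρ i j U y +
          (∑ y ∈ Sp i j, rr ρ i j (configDiagSwap i j U) y +
            ∑ y ∈ Sc i j, rr ρ i j (configDiagSwap i j U) y))) =
      -(β * (↑N * ↑(Fintype.card (Plaquette 2 L)))) + β * ∑ y ∈ S0 i j, rr ρ i j U y +
        β * ∑ y ∈ Sc i j, rr ρ i j U y + β * ∑ y ∈ Sp i j, rr ρ i j U y +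
        β * ∑ y ∈ Sp i j, rr ρ i j (configDiagSwap i j U) y +
        β * ∑ y ∈ Sc i j, rr ρ i j (configDiagSwap i j U) y by ring,
    Real.exp_add, Real.exp_add, Real.exp_add, Real.exp_add, Real.exp_add]
  push_cast
  ring

variable [MeasurableSpace G] [BorelSpace G] [SecondCountableTopology G]

omit [CompactSpace G] in
/-- `Φ_odd` is measurable. -/
theorem measurable_rpPhiOdd (hρ : Continuous ρ) (β : ℝ) {F : GaugeConfig 2 L G → ℂ}
    (hF : Measurable F) : Measurable (rpPhiOdd ρ i j β F) := by
  have hg := measurable_gObs ρ i j hρ β hF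
  have hΘ : Measurable (configDiagSwap (G := G) (L := L) i j) :=
    measurable_pi_lambda _ fun e => measurable_pi_apply _
  unfold rpPhiOdd
  exact (((hg.mul (Complex.continuous_conj.measurable.comp (hg.comp hΘ))).mul
    (measurable_mirrorE ρ hρ β)).mul (measurable_layerW ρ hρ β)).mul
      ((measurable_layerW ρ hρ β).comp hΘ)

end Integrand

end DiagRPTwo

end

end Summit.QuantumFields.GaugeBoot
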